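import Mathlib
import Summits.ResolutionOfSingularities.ResolutionOfSingularities.Theorems.DefectlessFramesDefectlessFramesRFrameOfAxisDropAt

/-!
# Shear drop: a `k`-rational direction of order `< p` at the centre implies the conclusion of
`DefectlessFramesR` (crux stmt-ResolutionOfSingularities-17921)

Helper of the line `Sketch` (lead c2, kernel sharpening). Let `(y; z; f)` be a hypersurface frame of `K/k` at the
rank-one zero-dimensional place `O ⊇ k` and `c : Fin n → k`. The SHEAR `y'ⱼ = yⱼ + cⱼ z`, `z' = z` is a
re-framing inside the same ring `k[y, z]`; its relation is `f(X - c X_n, X_n)` and its axis polynomial is the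
directional Taylor polynomial `g_c(T) = f^ρ(ȳ - c T, z̄ + T)` of `f` at the centre `(ȳ, z̄)` in the direction
`(-c, 1)`, recentred at `z̄`. Hence, if `g_c ≠ 0` has order `< p` at `T = 0` (and not more than the axis order of
`(y; z; f)` when the latter is in general position), the landed `stub_dfrFrameOfAxisDropAt` (Twist + Hensel
cluster budget + Ostrowski) gives the conclusion of the crux at `(y; z; f)`. Consequently the open kernel of the
crux may assume that EVERY `k`-rational direction through the centre has order `≥ p` on the hypersurface
(`p`-fold point), see `Cruxes/DefectlessFramesR/KERNEL.md` §6.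
-/

namespace Summit.ResolutionOfSingularities.ResolutionOfSingularities.Theorems

open Polynomial IsLocalRing Literature.AlgebraicGeometry.Resolution

section Shear

variable {k : Type*} [Field k] {n : ℕ}

/-- Evaluating a sheared polynomial: `(S_c g)(a, b) = g(a + c b, b)` for the shear
`S_c : X_j ↦ X_j + c_j X_n`, `X_n ↦ X_n`. [folklore] -/
theorem dfrShear_eval₂ {S : Type*} [CommRing S] (φ : k →+* S) (c : Fin n → k) (a : Fin n → S) (b : S)
    (g : MvPolynomial (Fin (n + 1)) k) :
    MvPolynomial.eval₂ φ (Fin.snoc a b)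
        (MvPolynomial.aeval (Fin.snoc (fun j => (MvPolynomial.X (Fin.castSucc j) : MvPolynomial (Fin (n + 1)) k) +
          MvPolynomial.C (c j) * MvPolynomial.X (Fin.last n)) (MvPolynomial.X (Fin.last n))) g)
      = MvPolynomial.eval₂ φ (Fin.snoc (fun j => a j + φ (c j) * b) b) g := by
  change MvPolynomial.eval₂Hom φ (Fin.snoc a b) (MvPolynomial.bind₁ _ g) = MvPolynomial.eval₂Hom φ _ g
  rw [MvPolynomial.eval₂Hom_bind₁]
  congr 2
  funext i
  refine Fin.lastCases ?_ (fun j => ?_) i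
  · simp
  · simp only [Fin.snoc_castSucc, map_add, map_mul, MvPolynomial.eval₂Hom_X', MvPolynomial.eval₂Hom_C,
      Fin.snoc_last]

/-- `S_c ∘ S_{-c} = id` for the shear. [folklore] -/
theorem dfrShear_comp_neg (c : Fin n → k) :
    (MvPolynomial.aeval (Fin.snoc (fun j => (MvPolynomial.X (Fin.castSucc j) : MvPolynomial (Fin (n + 1)) k) +
          MvPolynomial.C (c j) * MvPolynomial.X (Fin.last n)) (MvPolynomial.X (Fin.last n))) :
          MvPolynomial (Fin (n + 1)) k →ₐ[k] MvPolynomial (Fin (n + 1)) k).comp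
      (MvPolynomial.aeval (Fin.snoc (fun j => (MvPolynomial.X (Fin.castSucc j) : MvPolynomial (Fin (n + 1)) k) +
          MvPolynomial.C (-c j) * MvPolynomial.X (Fin.last n)) (MvPolynomial.X (Fin.last n))))
      = AlgHom.id k _ := by
  rw [MvPolynomial.comp_aeval, ← MvPolynomial.aeval_X_left]
  congr 1
  funext i
  refine Fin.lastCases ?_ (fun j => ?_) i
  · simp
  · simp only [Fin.snoc_castSucc, map_add, map_mul, map_neg, MvPolynomial.algHom_C, MvPolynomial.algebraMap_eq,
      MvPolynomial.aeval_X, Fin.snoc_last]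
    ring

/-- `S_c (S_{-c} g) = g` for the shear. [folklore] -/
theorem dfrShear_shear_neg (c : Fin n → k) (g : MvPolynomial (Fin (n + 1)) k) :
    MvPolynomial.aeval (Fin.snoc (fun j => (MvPolynomial.X (Fin.castSucc j) : MvPolynomial (Fin (n + 1)) k) +
          MvPolynomial.C (c j) * MvPolynomial.X (Fin.last n)) (MvPolynomial.X (Fin.last n)))
      (MvPolynomial.aeval (Fin.snoc (fun j => (MvPolynomial.X (Fin.castSucc j) : MvPolynomial (Fin (n + 1)) k) +
          MvPolynomial.C (-c j) * MvPolynomial.X (Fin.last n)) (MvPolynomial.X (Fin.last n))) g) = g := by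
  have := AlgHom.congr_fun (dfrShear_comp_neg c) g
  simpa only [AlgHom.comp_apply, AlgHom.id_apply] using this

/-- `S_{-c} (S_c g) = g` for the shear. [folklore] -/
theorem dfrShear_neg_shear (c : Fin n → k) (g : MvPolynomial (Fin (n + 1)) k) :
    MvPolynomial.aeval (Fin.snoc (fun j => (MvPolynomial.X (Fin.castSucc j) : MvPolynomial (Fin (n + 1)) k) +
          MvPolynomial.C (-c j) * MvPolynomial.X (Fin.last n)) (MvPolynomial.X (Fin.last n)))
      (MvPolynomial.aeval (Fin.snoc (fun j => (MvPolynomial.X (Fin.castSucc j) : MvPolynomial (Fin (n + 1)) k) +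
          MvPolynomial.C (c j) * MvPolynomial.X (Fin.last n)) (MvPolynomial.X (Fin.last n))) g) = g := by
  have h := dfrShear_shear_neg (fun j => -c j) g
  simpa only [neg_neg] using h

/-- Transport of a principal kernel along the shear: if `ker (g ↦ g(a, b)) = (f)` then
`ker (g ↦ g(a + c b, b)) = (S_{-c} f)`. [folklore] -/
theorem dfrShear_ker {K : Type*} [Field K] [Algebra k K] (c : Fin n → k)
    (a : Fin n → K) (b : K) (f : MvPolynomial (Fin (n + 1)) k)
    (hker : Ideal.span {f} = RingHom.ker (MvPolynomial.aeval (Fin.snoc a b) :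
      MvPolynomial (Fin (n + 1)) k →ₐ[k] K)) :
    Ideal.span {MvPolynomial.aeval (Fin.snoc (fun j => (MvPolynomial.X (Fin.castSucc j) : MvPolynomial (Fin (n + 1)) k) +
          MvPolynomial.C (-c j) * MvPolynomial.X (Fin.last n)) (MvPolynomial.X (Fin.last n))) f}
      = RingHom.ker (MvPolynomial.aeval (Fin.snoc (fun j => a j + algebraMap k K (c j) * b) b) :
          MvPolynomial (Fin (n + 1)) k →ₐ[k] K) := by
  have hev : ∀ g : MvPolynomial (Fin (n + 1)) k,
      MvPolynomial.aeval (Fin.snoc (fun j => a j + algebraMap k K (c j) * b) b) g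
        = MvPolynomial.aeval (Fin.snoc a b) (MvPolynomial.aeval (Fin.snoc (fun j =>
            (MvPolynomial.X (Fin.castSucc j) : MvPolynomial (Fin (n + 1)) k) +
            MvPolynomial.C (c j) * MvPolynomial.X (Fin.last n)) (MvPolynomial.X (Fin.last n))) g) := by
    intro g
    rw [MvPolynomial.aeval_def, MvPolynomial.aeval_def, ← MvPolynomial.coe_eval₂Hom, ← MvPolynomial.coe_eval₂Hom,
      MvPolynomial.coe_eval₂Hom, MvPolynomial.coe_eval₂Hom, dfrShear_eval₂]
  ext g
  rw [RingHom.mem_ker, hev g, ← RingHom.mem_ker, ← hker, Ideal.mem_span_singleton,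
    Ideal.mem_span_singleton]
  constructor
  · rintro ⟨q, hq⟩
    refine ⟨MvPolynomial.aeval (Fin.snoc (fun j => (MvPolynomial.X (Fin.castSucc j) : MvPolynomial (Fin (n + 1)) k) +
        MvPolynomial.C (c j) * MvPolynomial.X (Fin.last n)) (MvPolynomial.X (Fin.last n))) q, ?_⟩
    rw [hq, map_mul, dfrShear_shear_neg]
  · rintro ⟨q, hq⟩
    refine ⟨MvPolynomial.aeval (Fin.snoc (fun j => (MvPolynomial.X (Fin.castSucc j) : MvPolynomial (Fin (n + 1)) k) +
        MvPolynomial.C (-c j) * MvPolynomial.X (Fin.last n)) (MvPolynomial.X (Fin.last n))) q, ?_⟩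
    have := congrArg (MvPolynomial.aeval (Fin.snoc (fun j => (MvPolynomial.X (Fin.castSucc j) : MvPolynomial (Fin (n + 1)) k) +
        MvPolynomial.C (-c j) * MvPolynomial.X (Fin.last n)) (MvPolynomial.X (Fin.last n)))) hq
    rw [map_mul, dfrShear_neg_shear] at this
    exact this

/-- The axis polynomial of the sheared relation at the sheared centre `w + c t` is the directional Taylor
polynomial `g_c(T) = f(w - c T, t + T)` recentred at `t`: `(S_{-c} f)(C (w + c t), X) = g_c ∘ (X - t)`.
[folklore] -/
theorem dfrShear_axis {κ : Type*} [CommRing κ] (ρ : k →+* κ) (c : Fin n → k) (w : Fin n → κ) (t : κ)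
    (f : MvPolynomial (Fin (n + 1)) k) :
    MvPolynomial.eval₂ (Polynomial.C.comp ρ) (Fin.snoc (fun j => Polynomial.C (w j + ρ (c j) * t)) Polynomial.X)
        (MvPolynomial.aeval (Fin.snoc (fun j => (MvPolynomial.X (Fin.castSucc j) : MvPolynomial (Fin (n + 1)) k) +
          MvPolynomial.C (-c j) * MvPolynomial.X (Fin.last n)) (MvPolynomial.X (Fin.last n))) f)
      = (MvPolynomial.eval₂ (Polynomial.C.comp ρ)
          (Fin.snoc (fun j => Polynomial.C (w j) - Polynomial.C (ρ (c j)) * Polynomial.X)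
            (Polynomial.C t + Polynomial.X)) f).comp (Polynomial.X - Polynomial.C t) := by
  rw [dfrShear_eval₂]
  change _ = (Polynomial.compRingHom (Polynomial.X - Polynomial.C t))
    (MvPolynomial.eval₂Hom (Polynomial.C.comp ρ) _ f)
  rw [← RingHom.comp_apply, MvPolynomial.comp_eval₂Hom]
  have hC : (Polynomial.compRingHom (Polynomial.X - Polynomial.C t)).comp (Polynomial.C.comp ρ)
      = Polynomial.C.comp ρ := by
    ext r
    simp
  rw [hC, MvPolynomial.coe_eval₂Hom]
  congr 1
  funext i
  refine Fin.lastCases ?_ (fun j => ?_) i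
  · simp
  · simp only [Fin.snoc_castSucc, Polynomial.coe_compRingHom_apply, Polynomial.sub_comp, Polynomial.C_comp,
      Polynomial.mul_comp, Polynomial.X_comp, map_add, map_mul, map_neg, RingHom.coe_comp,
      Function.comp_apply]
    ring

/-- Recentring does not change the order: the multiplicity of `t` as a root of `g ∘ (X - t)` is the
multiplicity of `0` as a root of `g`. [folklore] -/
theorem dfrShear_rootMultiplicity_comp {κ : Type*} [CommRing κ] (g : κ[X]) (t : κ) :
    (g.comp (X - C t)).rootMultiplicity t = g.rootMultiplicity 0 := by
  rw [rootMultiplicity_eq_natTrailingDegree, rootMultiplicity_eq_natTrailingDegree, Polynomial.comp_assoc,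
    map_zero, add_zero, Polynomial.comp_X]
  congr 2
  have : (X - C t : κ[X]).comp (X + C t) = X := by simp
  rw [this, Polynomial.comp_X]

/-- `g ∘ (X - t) = 0` only if `g = 0`. [folklore] -/
theorem dfrShear_comp_ne_zero {κ : Type*} [CommRing κ] {g : κ[X]} (hg : g ≠ 0) (t : κ) :
    g.comp (X - C t) ≠ 0 := by
  intro h
  apply hg
  have h2 := congrArg (fun q : κ[X] => q.comp (X + C t)) h
  simp only [Polynomial.zero_comp, Polynomial.comp_assoc] at h2
  have : (X - C t : κ[X]).comp (X + C t) = X := by simp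
  rwa [this, Polynomial.comp_X] at h2

end Shear

section Valuation

variable {k K : Type*} [Field k] [Field K] [Algebra k K]

/-- The axis polynomial of a relation vanishes at the residue of the last generator: if `g(w, t) = 0` in `K`
with `w, t ∈ O`, then `g^ρ(w̄, X)` has the root `t̄`. [folklore] -/
theorem dfrShear_axis_eval_eq_zero (O : ValuationSubring K) (hk : ∀ c : k, algebraMap k K c ∈ O) {n : ℕ}
    (w : Fin n → O) (t : O) (g : MvPolynomial (Fin (n + 1)) k)
    (hg : MvPolynomial.aeval (Fin.snoc (fun j => (w j : K)) (t : K)) g = 0) :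
    (MvPolynomial.eval₂ (Polynomial.C.comp ((IsLocalRing.residue O).comp ((algebraMap k K).codRestrict O hk)))
      (Fin.snoc (fun j => Polynomial.C (IsLocalRing.residue O (w j))) Polynomial.X) g).eval
        (IsLocalRing.residue O t) = 0 := by
  set ι : k →+* O := (algebraMap k K).codRestrict O hk with hι
  have h1 : (Polynomial.evalRingHom (IsLocalRing.residue O t)).comp
      (MvPolynomial.eval₂Hom (Polynomial.C.comp ((IsLocalRing.residue O).comp ι))
        (Fin.snoc (fun j => Polynomial.C (IsLocalRing.residue O (w j))) Polynomial.X))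
      = (IsLocalRing.residue O).comp (MvPolynomial.eval₂Hom ι (Fin.snoc w t)) := by
    refine MvPolynomial.ringHom_ext (fun r => by simp) (fun i => ?_)
    refine Fin.lastCases ?_ (fun j => ?_) i
    · simp
    · simp
  have h2 : O.subtype.comp (MvPolynomial.eval₂Hom ι (Fin.snoc w t))
      = (MvPolynomial.aeval (Fin.snoc (fun j => (w j : K)) (t : K)) :
          MvPolynomial (Fin (n + 1)) k →ₐ[k] K).toRingHom := by
    refine MvPolynomial.ringHom_ext (fun r => ?_) (fun i => ?_)
    · simp [hι]
    · refine Fin.lastCases ?_ (fun j => ?_) i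
      · simp
      · simp
  have h3 : MvPolynomial.eval₂Hom ι (Fin.snoc w t) g = 0 := by
    apply O.subtype_injective
    rw [← RingHom.comp_apply, h2, map_zero]
    exact hg
  change (Polynomial.evalRingHom (IsLocalRing.residue O t))
    (MvPolynomial.eval₂Hom (Polynomial.C.comp ((IsLocalRing.residue O).comp ι)) _ g) = 0
  rw [← RingHom.comp_apply, h1, RingHom.comp_apply, h3, map_zero]

/-- **General position forces algebraic independence.** If the kernel of `g ↦ g(w, t)` is generated by `g`
and the axis polynomial `g^ρ(w̄, X)` is non-zero, then `w` is algebraically independent over `k`: otherwise a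
non-zero `h(X_0..X_{n-1})` lies in `(g)`, so `g` has `X_n`-degree `0`, and its axis polynomial is a constant
with the root `t̄`, i.e. zero. [folklore] -/
theorem dfrShear_algebraicIndependent (O : ValuationSubring K) (hk : ∀ c : k, algebraMap k K c ∈ O) {n : ℕ}
    (w : Fin n → O) (t : O) (g : MvPolynomial (Fin (n + 1)) k)
    (hker : Ideal.span {g} = RingHom.ker (MvPolynomial.aeval (Fin.snoc (fun j => (w j : K)) (t : K)) :
      MvPolynomial (Fin (n + 1)) k →ₐ[k] K))
    (hax : MvPolynomial.eval₂ (Polynomial.C.comp ((IsLocalRing.residue O).comp ((algebraMap k K).codRestrict O hk)))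
      (Fin.snoc (fun j => Polynomial.C (IsLocalRing.residue O (w j))) Polynomial.X) g ≠ 0) :
    AlgebraicIndependent k (fun j => (w j : K)) := by
  classical
  set ρ : k →+* IsLocalRing.ResidueField O := (IsLocalRing.residue O).comp ((algebraMap k K).codRestrict O hk)
    with hρ
  rw [algebraicIndependent_iff]
  intro h hh
  by_contra hne
  set P := (MvPolynomial.renameEquiv k finSuccEquivLast).trans (MvPolynomial.optionEquivLeft k (Fin n)) with hP
  have hH : MvPolynomial.aeval (Fin.snoc (fun j => (w j : K)) (t : K)) (MvPolynomial.rename Fin.castSucc h) = 0 := by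
    rw [MvPolynomial.aeval_rename, Fin.snoc_comp_castSucc]
    exact hh
  have hmem : MvPolynomial.rename Fin.castSucc h ∈ Ideal.span {g} := by
    rw [hker]
    exact hH
  obtain ⟨q, hq⟩ := Ideal.mem_span_singleton'.mp hmem
  have hdvd : P g ∣ Polynomial.C h := by
    refine ⟨P q, ?_⟩
    rw [← dfrTwist_fin_rename_castSucc h, ← hq, map_mul, mul_comm]
  have hh0 : (Polynomial.C h : Polynomial (MvPolynomial (Fin n) k)) ≠ 0 := by
    rwa [Ne, Polynomial.C_eq_zero]
  have hdeg : (P g).natDegree = 0 := by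
    have := Polynomial.natDegree_le_of_dvd hdvd hh0
    rw [Polynomial.natDegree_C] at this
    omega
  have hg' : g = MvPolynomial.rename Fin.castSucc ((P g).coeff 0) := by
    apply P.injective
    rw [dfrTwist_fin_rename_castSucc]
    exact Polynomial.eq_C_of_natDegree_eq_zero hdeg
  have hC : MvPolynomial.eval₂Hom (Polynomial.C.comp ρ) (fun j => Polynomial.C (IsLocalRing.residue O (w j)))
      = Polynomial.C.comp (MvPolynomial.eval₂Hom ρ fun j => IsLocalRing.residue O (w j)) :=
    MvPolynomial.ringHom_ext (fun r => by simp) (fun j => by simp)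
  have hax' : MvPolynomial.eval₂ (Polynomial.C.comp ρ)
      (Fin.snoc (fun j => Polynomial.C (IsLocalRing.residue O (w j))) Polynomial.X) g
        = Polynomial.C (MvPolynomial.eval₂ ρ (fun j => IsLocalRing.residue O (w j)) ((P g).coeff 0)) := by
    conv_lhs => rw [hg']
    rw [MvPolynomial.eval₂_rename, Fin.snoc_comp_castSucc, ← MvPolynomial.coe_eval₂Hom, hC]
    rfl
  have hev := dfrShear_axis_eval_eq_zero O hk w t g (by
    rw [← RingHom.mem_ker, ← hker]
    exact Ideal.mem_span_singleton_self g)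
  rw [hax', Polynomial.eval_C] at hev
  apply hax
  rw [hax', hev, map_zero]

end Valuation

/-- **Shear drop.** Let `(y; z; f)` be a hypersurface frame of `K/k` at the rank-one zero-dimensional place
`O ⊇ k` (`k` perfect of characteristic `p`) and `c : Fin n → k`. If the directional Taylor polynomial
`g_c(T) = f^ρ(ȳ - cT, z̄ + T)` of the relation at the centre in the `k`-rational direction `(-c, 1)` is non-zero of
order `< p` at `T = 0` (and of order not exceeding the axis order of `(y; z; f)` when that frame is in general
position), then the conclusion of `DefectlessFramesR` holds at `(y; z; f)`: the shear `(y + c z; z)` is a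
dominating frame in the same ring, in general position, of axis order `ord g_c < p`, and
`stub_dfrFrameOfAxisDropAt` applies. In particular the open kernel of the crux lives at centres where every
`k`-rational direction has order `≥ p` (`p`-fold points). [folklore] -/
theorem dfrShearDrop : ∀ p : ℕ, p.Prime → ∀ (k K : Type) [Field k] [CharP k p] [PerfectField k] [Field K] [Algebra k K], (⊤ : IntermediateField k K).FG → ∀ O : ValuationSubring K, ∀ hk : (∀ c : k, algebraMap k K c ∈ O), Nonempty O.valuation.RankOne → (∀ x ∈ O, ∃ f : Polynomial k, f ≠ 0 ∧ Polynomial.aeval x f ∈ O.nonunits) → let ρ : k →+* IsLocalRing.ResidueField O := (IsLocalRing.residue O).comp ((algebraMap k K).codRestrict O hk); let axis : (m : ℕ) → (Fin m → O) → MvPolynomial (Fin (m + 1)) k → Polynomial (IsLocalRing.ResidueField O) := fun _ w g => MvPolynomial.eval₂ (Polynomial.C.comp ρ) (Fin.snoc (fun j => Polynomial.C (IsLocalRing.residue O (w j))) Polynomial.X) g; ∀ (n : ℕ) (y : Fin n → O) (z : O) (f : MvPolynomial (Fin (n + 1)) k), AlgebraicIndependent k (fun i => (y i : K)) → IntermediateField.adjoin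 k (Set.range (fun i => (y i : K)) ∪ {(z : K)}) = ⊤ → Ideal.span {f} = RingHom.ker (MvPolynomial.aeval (Fin.snoc (fun i => (y i : K)) (z : K)) : MvPolynomial (Fin (n + 1)) k →ₐ[k] K) → f ≠ 0 → ∀ c : Fin n → k, let g : Polynomial (IsLocalRing.ResidueField O) := MvPolynomial.eval₂ (Polynomial.C.comp ρ) (Fin.snoc (fun j => Polynomial.C (IsLocalRing.residue O (y j)) - Polynomial.C (ρ (c j)) * Polynomial.X) (Polynomial.C (IsLocalRing.residue O z) + Polynomial.X)) f; g ≠ 0 → g.rootMultiplicity 0 < p → (axis n y f ≠ 0 → g.rootMultiplicity 0 ≤ (axis n y f).rootMultiplicity (IsLocalRing.residue O z)) → ∃ (y' : Fin n → O) (z' : O) (f' : MvPolynomial (Fin (n + 1)) k), AlgebraicIndependent k (fun i => (y' i : K)) ∧ IsIntegral (Algebra.adjoin k (Set.range fun i => (y' i : K))) (z' : K) ∧ IntermediateField.adjoin k (Set.range (fun i => (y' i : K)) ∪ {(z' : K)}) = ⊤ ∧ Ideal.span {f'} = RingHom.ker (MvPolynomial.aeval (Fin.snoc (fun i => (y' i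 : K)) (z' : K)) : MvPolynomial (Fin (n + 1)) k →ₐ[k] K) ∧ (∀ i, (y i : K) ∈ Algebra.adjoin k (Set.range (fun i => (y' i : K)) ∪ {(z' : K)})) ∧ (z : K) ∈ Algebra.adjoin k (Set.range (fun i => (y' i : K)) ∪ {(z' : K)}) ∧ axis n y' f' ≠ 0 ∧ (axis n y f ≠ 0 → (axis n y' f').rootMultiplicity (IsLocalRing.residue O z') ≤ (axis n y f).rootMultiplicity (IsLocalRing.residue O z)) ∧ IsSeparable (IntermediateField.adjoin k (Set.range fun i => (y' i : K))) (z' : K) ∧ ∀ (Ω : Type) [Field Ω] [Algebra K Ω] [IsAlgClosure K Ω] (V : ValuationSubring Ω), V.comap (algebraMap K Ω) = O → let F : Subfield Ω := (IntermediateField.adjoin k (Set.range fun i => (y' i : K))).toSubfield.map (algebraMap K Ω); Literature.AlgebraicGeometry.Resolution.IsDefectlessExtension V (Literature.AlgebraicGeometry.Resolution.henselization V F) (Literature.AlgebraicGeometry.Resolution.henselization V F ⊔ (algebraMap K Ω).fieldRange) := by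
  intro p hp k K _ _ _ _ _ hfg O hk hR hZ ρ axis n y z f hy hadj hker hf c g hg0 hlt hle
  -- the sheared frame `(y + c z; z; S_{-c} f)`
  set y₂ : Fin n → O := fun j => y j + ((algebraMap k K).codRestrict O hk (c j)) * z with hy₂
  set f₂ : MvPolynomial (Fin (n + 1)) k := MvPolynomial.aeval (Fin.snoc (fun j =>
      (MvPolynomial.X (Fin.castSucc j) : MvPolynomial (Fin (n + 1)) k) +
      MvPolynomial.C (-c j) * MvPolynomial.X (Fin.last n)) (MvPolynomial.X (Fin.last n))) f with hf₂def
  have hcoe : (Fin.snoc (fun j => ((y₂ j : O) : K)) (z : K) : Fin (n + 1) → K)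
      = Fin.snoc (fun j => (y j : K) + algebraMap k K (c j) * (z : K)) (z : K) := by
    congr 1
  have hker₂ : Ideal.span {f₂} = RingHom.ker (MvPolynomial.aeval (Fin.snoc (fun j => (y₂ j : K)) (z : K)) :
      MvPolynomial (Fin (n + 1)) k →ₐ[k] K) := by
    rw [hcoe]
    exact dfrShear_ker c (fun j => (y j : K)) (z : K) f hker
  have hf₂ : f₂ ≠ 0 := by
    intro h
    apply hf
    rw [← dfrShear_shear_neg c f]
    change MvPolynomial.aeval _ f₂ = 0
    rw [h, map_zero]
  have hres : (fun j => Polynomial.C (IsLocalRing.residue O (y₂ j)))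
      = fun j => Polynomial.C (IsLocalRing.residue O (y j) + ρ (c j) * IsLocalRing.residue O z) := by
    funext j
    simp only [hy₂, map_add, map_mul]
    rfl
  have hax₂ : axis n y₂ f₂ = g.comp (Polynomial.X - Polynomial.C (IsLocalRing.residue O z)) := by
    show MvPolynomial.eval₂ (Polynomial.C.comp ρ)
      (Fin.snoc (fun j => Polynomial.C (IsLocalRing.residue O (y₂ j))) Polynomial.X) f₂ = _
    rw [hres]
    exact dfrShear_axis ρ c (fun j => IsLocalRing.residue O (y j)) (IsLocalRing.residue O z) f
  have hax₂ne : axis n y₂ f₂ ≠ 0 := by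
    rw [hax₂]
    exact dfrShear_comp_ne_zero hg0 _
  have hmult : (axis n y₂ f₂).rootMultiplicity (IsLocalRing.residue O z) = g.rootMultiplicity 0 := by
    rw [hax₂]
    exact dfrShear_rootMultiplicity_comp g _
  have hy₂ind : AlgebraicIndependent k (fun j => (y₂ j : K)) :=
    dfrShear_algebraicIndependent O hk y₂ z f₂ hker₂ hax₂ne
  have hdomz : (z : K) ∈ Algebra.adjoin k (Set.range (fun j => (y₂ j : K)) ∪ {(z : K)}) :=
    Algebra.subset_adjoin (Or.inr rfl)
  have hdomy : ∀ i, (y i : K) ∈ Algebra.adjoin k (Set.range (fun j => (y₂ j : K)) ∪ {(z : K)}) := by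
    intro i
    have h1 : (y₂ i : K) ∈ Algebra.adjoin k (Set.range (fun j => (y₂ j : K)) ∪ {(z : K)}) :=
      Algebra.subset_adjoin (Or.inl ⟨i, rfl⟩)
    have : (y i : K) = (y₂ i : K) - algebraMap k K (c i) * (z : K) := by
      have := congrFun hcoe (Fin.castSucc i)
      simp only [Fin.snoc_castSucc] at this
      rw [this]
      ring
    rw [this]
    exact Subalgebra.sub_mem _ h1 (Subalgebra.mul_mem _ (Subalgebra.algebraMap_mem _ _) hdomz)
  have hadj₂ : IntermediateField.adjoin k (Set.range (fun j => (y₂ j : K)) ∪ {(z : K)}) = ⊤ := by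
    rw [eq_top_iff, ← hadj, IntermediateField.adjoin_le_iff]
    rintro x (⟨i, rfl⟩ | hx)
    · exact IntermediateField.algebra_adjoin_le_adjoin _ _ (hdomy i)
    · rw [Set.mem_singleton_iff] at hx
      rw [hx]
      exact IntermediateField.subset_adjoin _ _ (Or.inr rfl)
  refine stub_dfrFrameOfAxisDropAt p hp k K hfg O hk hR hZ n y z f hy hadj hker hf
    ⟨y₂, z, f₂, hy₂ind, hadj₂, hker₂, hf₂, hdomy, hdomz, hax₂ne, ?_, fun hax => ?_⟩
  · rw [hmult]
    exact hlt
  · rw [hmult]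
    exact hle hax

end Summit.ResolutionOfSingularities.ResolutionOfSingularities.Theorems
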